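/-
Copyright (c) 2026 the pub-hodgecm-mathlib formalisation cell (harness21).  Prover seat hodgecm-mathlib-R90-CS-p03 (g3), R90-TF section S8 «ContSpec-n½» (dealer R90-CS-plan (g3),
S8-R198 (1) second half «`K2E1ChiArchA32FiniteHalfOfRecordU3` — `hA32f : Cf (3∕2) ≠ 0`»; census `R90/S8/CENSUS-A32-FiniteHalfOfRecord.R90-CS-p03-g3.md`): the FINITE HALF
`Cf z = C·∏_{v∈S₀} m_v(z)` of the factorised amplitude of record is a `z`-FREE NON-ZERO constant when the bad-place weights are TEST WEIGHTS (★ (a-4)), and ★ g2's `hA32_of_record`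
with that `Cf` — ★ F5's `hA32` bytes for the fully NAMED amplitude, letters {coupling range `hm`, unit `hu`, Haar constant `hC`, the test-weight data at `S₀`}.
-/
import Summits.HodgeConjecture.HodgeConjecture.Theorems.K2E1ChiArchA32OfRecordU3        -- ★ p863956 (R90-CS-p03 (g2)): `hA32_of_record` (arch half ★ (a-10c) × one finite-half letter `hA32f`)
import Summits.HodgeConjecture.HodgeConjecture.Theorems.K2E1ChiLocalMeanTestWeightU3     -- ★ (a-4) p863341 (R90-CS-p03 (g2)): `chiLocalMean_ne_zero_of_testWeight`, `exists_testBall`; brings ★ (a-1)'s local-mean currency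
import HarnessLib

/-!
# K2·E1 ∕ R90·S8 — `K2E1ChiArchA32FiniteHalfOfRecordU3`: THE FINITE HALF `Cf z = C·∏_{v∈S₀} m_v(z)` OF ★ F5's `hA32` IS A NON-ZERO CONSTANT FOR TEST WEIGHTS, AND `hA32` FOR THE
# FULLY NAMED AMPLITUDE OF RECORD

Cell `pub/hodgecm-mathlib`, crux h413 = `stmt-HodgeConjecture-24833`, route of record `HCCMUnconditional`; R90-TF section S8 «ContSpec-n½», road R2-χ₃ (the (V) scalar road; ★ F5's
binder `hA32 : A (3∕2) ≠ 0`, (V) OF RECORD ★ p863986 row (iii)).  THEOREMS ONLY (no `def`, no `instance`, no notation, no named-fact hypothesis, no `sorry`; default heartbeats); lane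
`--supports stmt-HodgeConjecture-24833 --as helper` (count-neutral).  Closes no socket.

THE MATHEMATICS ([MoeglinWaldspurger1995] II.1.6–II.1.7, IV.1.11; [Rogawski1990] §4.5, §13.9 p. 229; [Langlands1976] Appendix).  By ★ (a-2b) `exists_pos_inv_measure_smul_integral_eq_chiEulerProduct_three`
the intertwining scalar of the witness section factorises as `q(z) = C·(∫_{L_∞}∫_{L⁺_∞} ω_∞·ARCH₃^{−z})·(∏_{v∈S₀} m_v(z))·c_χ^S(z)` with ONE Haar constant `C > 0`, the bad-place χ-local means
`m_v(z) = ν_v(𝒪_v³)⁻¹ • ∫ ω_v(p)·Q_v(p)^{−z} dν_v³(p)` (★ (a-1)'s bytes) and the good-place Euler quotient `c_χ^S`; ★ F5's `hsrc` reads `A := C·(∫∫ ω_∞·ARCH₃^{−z})·∏_{v∈S₀} m_v`, and ★ g2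
`K2E1ChiArchA32OfRecordU3.hA32_of_record` proves `A(3∕2) ≠ 0` for the IDENTIFIED archimedean weight of record from the letters `hm` (coupling range `|m_w| ≤ 2`), `hu` and ONE finite-half
letter `hA32f : Cf (3∕2) ≠ 0`, `Cf` abstract.  THIS FILE instantiates `Cf := fun z => C * ∏ v ∈ S₀, m_v(z)` and DISCHARGES `hA32f` when every bad-place weight `ω_v` (`v ∈ S₀`) is a TEST
WEIGHT — `ω_v = c_v ≠ 0` on a measurable set `B_v` of positive finite volume on which the local height `Q_v` is `1`, `ω_v = 0` off `B_v` (★ (a-4) `exists_testBall`: such a ball exists at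
EVERY finite place, no arithmetic hypothesis) — for then `m_v(z) = c_v·ν_v³(B_v)∕ν_v³(𝒪_v³)` is a `z`-FREE non-zero constant (★ (a-4) `chiLocalMean_ne_zero_of_testWeight`) and `Cf z ≠ 0` for
EVERY `z`, in particular at `3∕2`.
* §1 **`finiteHalf_ne_zero_of_testWeights`** — `C ≠ 0` + test weights at every `v ∈ S₀` ⇒ `C * ∏ v ∈ S₀, m_v(z) ≠ 0` for every `z`.
* §2 HEAD **`hA32_of_record_of_testWeights`** — ★ g2 `hA32_of_record`'s conclusion (★ F5's `A (3 / 2) ≠ 0` bytes for the factorised amplitude) with `Cf := C·∏_{v∈S₀} m_v` and `hA32f` DISCHARGED;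
  VISIBLE LETTERS exactly {`hm : ∀ w, |m w| ≤ 2` (S8-R192: `= 1` on the unit-coupling blocks of record; `|m_w| ≥ 3` is the (∞-2) estate), `hu : u ≠ 0`, `hC : C ≠ 0` (★ (a-2b) gives `C > 0`),
  the test-weight data `B c ω hBm hBpos hBfin hQ hc hωB hω0` at `S₀`}.
HONEST SCOPE (structural finding F-A32, census item 3): NOT here — that the bad-place weights of the WITNESS OF RECORD ARE test weights.  ★ FILE 2 `exists_finLevelSection` (p11) exports no
SUPPORT CLAUSE for the finite-level section `Φf`, so the weights of the existential witness (★ 3d ∕ `midWitness*`) are unreadable; and for the identity-supported `Φf` at base point `g₁ = 1`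
the weight at a `χ₁`-ramified place is an oscillating character average, not a volume.  The repair is statement-side (base point `g₁ := ι_f(w₀^{S₀})` or a big-cell-supported witness, with
`𝔫` divisible by every place of `S₀`) and needs the exports (E-supp) «support clause of `Φf`» and (E-cell) «`w₀·u(p)·w₀⁻¹ ∈ N⁻`, in `B_v·K_v(𝔫)` iff `p` in the `𝔫_v`-ball» — named for the dealer.
HONEST LABEL: HC_CM is proved only modulo the 7 printed citations (2 remaining named inputs: hLiu418 = `stmt-HodgeConjecture-24832`, h413 = `stmt-HodgeConjecture-24833`) until rung 0
closes; REL ≠ ★ ≠ BUILT; this file asserts no named fact and closes no socket; (V)(iii) `hA32` = this × (E-supp) × (E-cell) × the base-point ruling; count-neutral; unconditional local analysis.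

## References
* [MoeglinWaldspurger1995] C. Mœglin, J.-L. Waldspurger, *Spectral Decomposition and Eisenstein Series* (1995): II.1.6, II.1.7, IV.1.11.
* [Rogawski1990] J. D. Rogawski, *Automorphic Representations of Unitary Groups in Three Variables*, Ann. of Math. Stud. 123 (1990): §4.5, §13.9 p. 229.
* [Langlands1976] R. P. Langlands, *On the Functional Equations Satisfied by Eisenstein Series*, LNM 544 (1976): Appendix (rank one).
* [TateThesis1967] J. Tate, *Fourier analysis in number fields and Hecke's zeta-functions* (1967): §3.3.
-/

set_option autoImplicit false
set_option linter.dupNamespace false -- the mandated namespace repeats `HodgeConjecture.HodgeConjecture`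

noncomputable section

open MeasureTheory MeasureTheory.Measure NumberField NumberField.InfinitePlace IsDedekindDomain Filter Set
open scoped NNReal ENNReal
open Literature.NumberTheory.Automorphic Literature.NumberTheory.Automorphic.UnitaryGroup Literature.NumberTheory.GaloisRepresentations
open Literature.NumberTheory.GaloisRepresentations (archUnitaryValue)
open Literature.NumberTheory.GaloisRepresentations.IsNonarchimedeanLocalField
open Summit.HodgeConjecture.HodgeConjecture.Cruxes.H413
open Summit.HodgeConjecture.HodgeConjecture.Cruxes.H413.K2E1ChiLocalMeanTestWeightU3 (chiLocalMean_ne_zero_of_testWeight)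
open Summit.HodgeConjecture.HodgeConjecture.Cruxes.H413.K2E1ChiArchA32OfRecordU3 (hA32_of_record)

namespace Summit.HodgeConjecture.HodgeConjecture.Cruxes.H413.K2E1ChiArchA32FiniteHalfOfRecordU3

variable (L : Type) [Field L] [NumberField L] [IsCMField L] {δ : L} (hcδ : IsCMField.complexConj L δ = -δ) (hδ : δ ≠ 0)
  [∀ v : HeightOneSpectrum (𝓞 ↥(maximalRealSubfield L)), MeasurableSpace (v.adicCompletion ↥(maximalRealSubfield L))] [∀ v : HeightOneSpectrum (𝓞 ↥(maximalRealSubfield L)), BorelSpace (v.adicCompletion ↥(maximalRealSubfield L))]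
  (νv : ∀ v : HeightOneSpectrum (𝓞 ↥(maximalRealSubfield L)), Measure (v.adicCompletion ↥(maximalRealSubfield L))) [∀ v, (νv v).IsAddHaarMeasure]

/-! ## §1 The finite half is a `z`-free non-zero constant for test weights -/

omit [∀ v : HeightOneSpectrum (𝓞 ↥(maximalRealSubfield L)), BorelSpace (v.adicCompletion ↥(maximalRealSubfield L))] in
/-- **THE FINITE HALF `C·∏_{v∈S₀} m_v(z)` IS NON-ZERO FOR EVERY `z` WHEN THE BAD-PLACE WEIGHTS ARE TEST WEIGHTS**: `C ≠ 0`, and at every `v ∈ S₀` the weight `ω_v` equals `c_v ≠ 0` on a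
measurable `B_v` of positive finite `ν_v³`-volume on which `Q_v = 1` and vanishes off `B_v` — then each `m_v(z) = c_v·ν_v³(B_v)∕ν_v³(𝒪_v³) ≠ 0` (★ (a-4) `chiLocalMean_ne_zero_of_testWeight`), so
the product is non-zero (`Finset.prod_ne_zero_iff`).  ★ (a-1)'s `m_v(z)` bytes. [cite: MoeglinWaldspurger1995, II.1.6, IV.1.11] [cite: Rogawski1990, §4.5] [cite: TateThesis1967, §3.3] -/
theorem finiteHalf_ne_zero_of_testWeights (S₀ : Finset (HeightOneSpectrum (𝓞 ↥(maximalRealSubfield L))))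
    (B : ∀ v : HeightOneSpectrum (𝓞 ↥(maximalRealSubfield L)), Set (Fin 3 → v.adicCompletion ↥(maximalRealSubfield L))) (hBm : ∀ v ∈ S₀, MeasurableSet (B v))
    (hBpos : ∀ v ∈ S₀, 0 < (Measure.pi fun _ : Fin 3 => νv v) (B v)) (hBfin : ∀ v ∈ S₀, (Measure.pi fun _ : Fin 3 => νv v) (B v) < ⊤)
    (hQ : ∀ v ∈ S₀, ∀ p ∈ B v, (∏ w' : PlacesOver L v, max 1 (max ((normAbs (w'.1.adicCompletion L) (quadraticLocalEquiv L v (IsCMField.complexConj L) hcδ hδ (p 0, p 1) w') : ℝ≥0) : ℝ)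
            ((normAbs (w'.1.adicCompletion L) ((toLocalRing L v (p 2) * algebraMap L (LocalRing L v) δ -
              toLocalRing L v 2⁻¹ * (quadraticLocalEquiv L v (IsCMField.complexConj L) hcδ hδ (p 0, p 1) *
                conjLocal L (IsCMField.complexConj L) v (quadraticLocalEquiv L v (IsCMField.complexConj L) hcδ hδ (p 0, p 1)))) w') : ℝ≥0) : ℝ))) = 1)
    (c : HeightOneSpectrum (𝓞 ↥(maximalRealSubfield L)) → ℂ) (hc : ∀ v ∈ S₀, c v ≠ 0)
    (ω : ∀ v : HeightOneSpectrum (𝓞 ↥(maximalRealSubfield L)), (Fin 3 → v.adicCompletion ↥(maximalRealSubfield L)) → ℂ)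
    (hωB : ∀ v ∈ S₀, ∀ p ∈ B v, ω v p = c v) (hω0 : ∀ v ∈ S₀, ∀ p ∉ B v, ω v p = 0) {C : ℂ} (hC : C ≠ 0) (z : ℂ) :
    C * ∏ v ∈ S₀, ((Measure.pi fun _ : Fin 3 => νv v) (integralBox ↥(maximalRealSubfield L) (Fin 3) v)).toReal⁻¹ •
        ∫ p : Fin 3 → v.adicCompletion ↥(maximalRealSubfield L),
          ω v p * (((∏ w' : PlacesOver L v, max 1 (max ((normAbs (w'.1.adicCompletion L) (quadraticLocalEquiv L v (IsCMField.complexConj L) hcδ hδ (p 0, p 1) w') : ℝ≥0) : ℝ)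
            ((normAbs (w'.1.adicCompletion L) ((toLocalRing L v (p 2) * algebraMap L (LocalRing L v) δ -
              toLocalRing L v 2⁻¹ * (quadraticLocalEquiv L v (IsCMField.complexConj L) hcδ hδ (p 0, p 1) *
                conjLocal L (IsCMField.complexConj L) v (quadraticLocalEquiv L v (IsCMField.complexConj L) hcδ hδ (p 0, p 1)))) w') : ℝ≥0) : ℝ))) : ℝ) : ℂ) ^ (-z) ∂(Measure.pi fun _ : Fin 3 => νv v) ≠ 0 :=
  mul_ne_zero hC (Finset.prod_ne_zero_iff.2 fun v hv =>
    chiLocalMean_ne_zero_of_testWeight L hcδ hδ v (νv v) (hBm v hv) (hBpos v hv) (hBfin v hv) (hQ v hv) (hc v hv) (ω v) (hωB v hv) (hω0 v hv) z)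

/-! ## §2 HEAD: ★ F5's `hA32` for the fully named amplitude of record, at test weights -/

section Head

variable [MeasurableSpace (InfiniteAdeleRing L)] [BorelSpace (InfiniteAdeleRing L)]
  [MeasurableSpace (InfiniteAdeleRing ↥(maximalRealSubfield L))] [BorelSpace (InfiniteAdeleRing ↥(maximalRealSubfield L))]
  (μE₁ : Measure (InfiniteAdeleRing L)) [μE₁.IsAddHaarMeasure] (μF₁ : Measure (InfiniteAdeleRing ↥(maximalRealSubfield L))) [μF₁.IsAddHaarMeasure]

omit [∀ v : HeightOneSpectrum (𝓞 ↥(maximalRealSubfield L)), BorelSpace (v.adicCompletion ↥(maximalRealSubfield L))] in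
include hcδ hδ in
/-- **HEAD.  ★ F5's `hA32` FOR THE FULLY NAMED AMPLITUDE OF RECORD `A z := (C·∏_{v∈S₀} m_v(z)) · ∫_{L_∞}∫_{L⁺_∞} (u·∏_w archUnitaryValue (m_w) 0 ζ_w)·ARCH₃^{−z}`, AT TEST WEIGHTS**: ★ g2
`hA32_of_record` with `Cf := fun z => C * ∏ v ∈ S₀, m_v(z)` and its finite-half letter `hA32f` DISCHARGED by §1.  Visible letters: the coupling range `hm : ∀ w, |m w| ≤ 2`, the unit
`hu : u ≠ 0`, the Haar constant `hC : C ≠ 0`, and the test-weight data at the bad places `S₀`. [cite: MoeglinWaldspurger1995, II.1.7, IV.1.11] [cite: Langlands1976, Appendix] [cite: Rogawski1990, §13.9 p. 229] -/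
theorem hA32_of_record_of_testWeights (m : InfinitePlace L → ℤ) (hm : ∀ w, |m w| ≤ 2) (u : ℂ) (hu : u ≠ 0)
    (S₀ : Finset (HeightOneSpectrum (𝓞 ↥(maximalRealSubfield L))))
    (B : ∀ v : HeightOneSpectrum (𝓞 ↥(maximalRealSubfield L)), Set (Fin 3 → v.adicCompletion ↥(maximalRealSubfield L))) (hBm : ∀ v ∈ S₀, MeasurableSet (B v))
    (hBpos : ∀ v ∈ S₀, 0 < (Measure.pi fun _ : Fin 3 => νv v) (B v)) (hBfin : ∀ v ∈ S₀, (Measure.pi fun _ : Fin 3 => νv v) (B v) < ⊤)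
    (hQ : ∀ v ∈ S₀, ∀ p ∈ B v, (∏ w' : PlacesOver L v, max 1 (max ((normAbs (w'.1.adicCompletion L) (quadraticLocalEquiv L v (IsCMField.complexConj L) hcδ hδ (p 0, p 1) w') : ℝ≥0) : ℝ)
            ((normAbs (w'.1.adicCompletion L) ((toLocalRing L v (p 2) * algebraMap L (LocalRing L v) δ -
              toLocalRing L v 2⁻¹ * (quadraticLocalEquiv L v (IsCMField.complexConj L) hcδ hδ (p 0, p 1) *
                conjLocal L (IsCMField.complexConj L) v (quadraticLocalEquiv L v (IsCMField.complexConj L) hcδ hδ (p 0, p 1)))) w') : ℝ≥0) : ℝ))) = 1)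
    (c : HeightOneSpectrum (𝓞 ↥(maximalRealSubfield L)) → ℂ) (hc : ∀ v ∈ S₀, c v ≠ 0)
    (ω : ∀ v : HeightOneSpectrum (𝓞 ↥(maximalRealSubfield L)), (Fin 3 → v.adicCompletion ↥(maximalRealSubfield L)) → ℂ)
    (hωB : ∀ v ∈ S₀, ∀ p ∈ B v, ω v p = c v) (hω0 : ∀ v ∈ S₀, ∀ p ∉ B v, ω v p = 0) {C : ℂ} (hC : C ≠ 0) :
    (fun z : ℂ => (C * ∏ v ∈ S₀, ((Measure.pi fun _ : Fin 3 => νv v) (integralBox ↥(maximalRealSubfield L) (Fin 3) v)).toReal⁻¹ •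
        ∫ p : Fin 3 → v.adicCompletion ↥(maximalRealSubfield L),
          ω v p * (((∏ w' : PlacesOver L v, max 1 (max ((normAbs (w'.1.adicCompletion L) (quadraticLocalEquiv L v (IsCMField.complexConj L) hcδ hδ (p 0, p 1) w') : ℝ≥0) : ℝ)
            ((normAbs (w'.1.adicCompletion L) ((toLocalRing L v (p 2) * algebraMap L (LocalRing L v) δ -
              toLocalRing L v 2⁻¹ * (quadraticLocalEquiv L v (IsCMField.complexConj L) hcδ hδ (p 0, p 1) *
                conjLocal L (IsCMField.complexConj L) v (quadraticLocalEquiv L v (IsCMField.complexConj L) hcδ hδ (p 0, p 1)))) w') : ℝ≥0) : ℝ))) : ℝ) : ℂ) ^ (-z) ∂(Measure.pi fun _ : Fin 3 => νv v)) *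
      ∫ Xi : InfiniteAdeleRing L, ∫ a : InfiniteAdeleRing ↥(maximalRealSubfield L),
      (u * ∏ w : InfinitePlace L, archUnitaryValue (m w) 0 ((((-(1 + ‖Xi w‖ ^ 2 / 2)) : ℝ) : ℂ) +
          (((w.embedding δ).im * ((InfiniteAdeleRing.ringEquiv_mixedSpace ↥(maximalRealSubfield L)) a).1 ⟨w.comap (algebraMap ↥(maximalRealSubfield L) L), K2E1HeightBigCellLineFormulaU2.isReal_comap_maximalRealSubfield L w⟩ : ℝ) : ℂ) * Complex.I)) *
        ((((∏ w : InfinitePlace L, ((1 + ‖(Xi) w‖ ^ 2 / 2) ^ 2 + (w δ) ^ 2 * (((InfiniteAdeleRing.ringEquiv_mixedSpace ↥(maximalRealSubfield L)) a).1 ⟨w.comap (algebraMap ↥(maximalRealSubfield L) L), K2E1HeightBigCellLineFormulaU2.isReal_comap_maximalRealSubfield L w⟩) ^ 2))) : ℝ) : ℂ) ^ (-z) ∂μF₁ ∂μE₁) (3 / 2) ≠ 0 :=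
  hA32_of_record L hcδ hδ μE₁ μF₁ m hm u hu
    (fun z : ℂ => C * ∏ v ∈ S₀, ((Measure.pi fun _ : Fin 3 => νv v) (integralBox ↥(maximalRealSubfield L) (Fin 3) v)).toReal⁻¹ •
        ∫ p : Fin 3 → v.adicCompletion ↥(maximalRealSubfield L),
          ω v p * (((∏ w' : PlacesOver L v, max 1 (max ((normAbs (w'.1.adicCompletion L) (quadraticLocalEquiv L v (IsCMField.complexConj L) hcδ hδ (p 0, p 1) w') : ℝ≥0) : ℝ)
            ((normAbs (w'.1.adicCompletion L) ((toLocalRing L v (p 2) * algebraMap L (LocalRing L v) δ -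
              toLocalRing L v 2⁻¹ * (quadraticLocalEquiv L v (IsCMField.complexConj L) hcδ hδ (p 0, p 1) *
                conjLocal L (IsCMField.complexConj L) v (quadraticLocalEquiv L v (IsCMField.complexConj L) hcδ hδ (p 0, p 1)))) w') : ℝ≥0) : ℝ))) : ℝ) : ℂ) ^ (-z) ∂(Measure.pi fun _ : Fin 3 => νv v))
    (finiteHalf_ne_zero_of_testWeights L hcδ hδ νv S₀ B hBm hBpos hBfin hQ c hc ω hωB hω0 hC (3 / 2))

end Head

end Summit.HodgeConjecture.HodgeConjecture.Cruxes.H413.K2E1ChiArchA32FiniteHalfOfRecordU3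

end
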